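import Summits.MatrixMultiplication.MatrixMultiplication.Theorems.GradedDesignFamily.Negative.SubfieldCellTwistedCentralizer

/-!
# Subfield cell: the slice count (D) — `#{X ∈ SL₂(K) | σX = X⁻¹, tr X = t, tr(mX) = c} ≤ 4q`

Unit `b2b-lgcu-subfield` (gen 20), supporting `stmt-MatrixMultiplication-7610`; the last counting
lemma of the BGT-free plan (SUBFIELD.md §25): for `|K| = q²`, `σ = Frob_q`, `m ∈ SL₂(K)`, `m ≠ ±1`
and `t, c ∈ K`, the slice `{X ∈ SL₂(K) | σ(X) = X⁻¹, tr X = t, tr(m X) = c}` has at most `4q`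
elements (`subfieldCell_sliceCount_le`; the true bound is `2q`: it is an affine-plane section of a
rank-3 quadric over `k`).

Elementary proof by elimination.  Writing `X = [[a, β], [γ, d]]`, the conditions give `d = t - a`,
`a^q + a = t`, `β^q + β = 0 = γ^q + γ`, (Q) `a(t-a) - βγ = 1`, (L) `δa + m₁₀β + m₀₁γ = c'`
(`δ = m₀₀ - m₁₁`, `c' = c - m₁₁ t`), and `X ↦ (a, β, γ)` is injective.  If `m₀₁ ≠ 0`, (L) determines
`γ`, and (Q) becomes `m₁₀β² - (c' - δa)β + m₀₁(a(t-a) - 1) = 0`: at most two `β` per `a` unless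
`a(t-a) = 1` (at most two such `a`) — at most `2q + 2q` pairs; `m₁₀ ≠ 0` is symmetric; if
`m₀₁ = m₁₀ = 0` then `δ ≠ 0` (as `m ≠ ±1`), `a` is forced and `βγ` is fixed: at most `2q` pairs.

HONEST FRAMING: a finite-field counting lemma toward the unconditional `¬ stub_subfieldCell`;
NOT summit progress.  Sorry-free. [folklore]
-/

set_option linter.dupNamespace false

namespace Summit.MatrixMultiplication.MatrixMultiplication.Theorems.GradedDesignFamily.Negative

open scoped MatrixGroups
open Matrix.SpecialLinearGroup

/-! ## Root counts -/

open Polynomial in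
/-- `#{x | x^q + x = s} ≤ q` for `2 ≤ q`. [folklore] -/
theorem card_filter_pow_add_self_le {F : Type} [Field F] [Fintype F] [DecidableEq F] (q : ℕ)
    (hq : 2 ≤ q) (s : F) : (Finset.univ.filter fun x : F => x ^ q + x = s).card ≤ q := by
  set p : F[X] := X ^ q + (X + C (-s)) with hp
  have h1 : (X + C (-s) : F[X]).natDegree < (X ^ q : F[X]).natDegree := by
    rw [natDegree_X_add_C, natDegree_X_pow]; omega
  have hdeg : p.natDegree = q := by
    rw [hp, natDegree_add_eq_left_of_natDegree_lt h1, natDegree_X_pow]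
  have hp0 : p ≠ 0 := by
    intro h0; rw [h0, natDegree_zero] at hdeg; omega
  have hsub : (Finset.univ.filter fun x : F => x ^ q + x = s) ⊆ p.roots.toFinset := by
    intro x hx
    simp only [Finset.mem_filter, Finset.mem_univ, true_and] at hx
    rw [Multiset.mem_toFinset, Polynomial.mem_roots hp0]
    simp only [hp, IsRoot.def, eval_add, eval_pow, eval_X, eval_C]
    linear_combination hx
  calc _ ≤ p.roots.toFinset.card := Finset.card_le_card hsub
    _ ≤ p.roots.card := Multiset.toFinset_card_le _
    _ ≤ p.natDegree := Polynomial.card_roots' _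
    _ = q := hdeg

open Polynomial in
/-- A quadratic-or-lower equation with nonzero constant term has at most two solutions. [folklore] -/
theorem card_filter_quadratic_le_of_ne {F : Type} [Field F] [Fintype F] [DecidableEq F]
    (a b c : F) (hc : c ≠ 0) :
    (Finset.univ.filter fun x : F => a * x ^ 2 + b * x + c = 0).card ≤ 2 := by
  set p : F[X] := C a * X ^ 2 + C b * X + C c with hp
  have hp0 : p ≠ 0 := by
    intro h0
    have := congrArg (fun r : F[X] => r.coeff 0) h0
    simp [hp] at this
    exact hc this
  have hsub : (Finset.univ.filter fun x : F => a * x ^ 2 + b * x + c = 0) ⊆ p.roots.toFinset := by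
    intro x hx
    simp only [Finset.mem_filter, Finset.mem_univ, true_and] at hx
    rw [Multiset.mem_toFinset, Polynomial.mem_roots hp0]
    simp [hp, hx]
  calc _ ≤ p.roots.toFinset.card := Finset.card_le_card hsub
    _ ≤ p.roots.card := Multiset.toFinset_card_le _
    _ ≤ p.natDegree := Polynomial.card_roots' _
    _ ≤ 2 := Polynomial.natDegree_quadratic_le

/-! ## Counting triples -/

/-- **Elimination count.**  Triples `(a, x, y)` with `a ∈ A`, `x ∈ B`, `a(t-a) - xy = 1` and
`δa + vx + uy = c'` (`u ≠ 0`): at most `2|A| + 2|B|`. [folklore] -/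
theorem card_triples_elim_le {F : Type} [Field F] [Fintype F] [DecidableEq F] (A B : Finset F)
    (t δ c' u v : F) (hu : u ≠ 0) (S : Finset (F × F × F))
    (hS : ∀ p ∈ S, p.1 ∈ A ∧ p.2.1 ∈ B ∧ p.1 * (t - p.1) - p.2.1 * p.2.2 = 1 ∧
      δ * p.1 + v * p.2.1 + u * p.2.2 = c') :
    S.card ≤ 2 * A.card + 2 * B.card := by
  -- `(a, x)` determines `y`
  have hinj : Set.InjOn (fun p : F × F × F => (p.1, p.2.1)) ↑S := by
    intro p hp p' hp' e
    simp only [Prod.mk.injEq] at e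
    obtain ⟨e1, e2⟩ := e
    have h := (hS p hp).2.2.2
    have h' := (hS p' hp').2.2.2
    rw [e1, e2] at h
    have e3 : p.2.2 = p'.2.2 := by
      have : u * p.2.2 = u * p'.2.2 := by linear_combination h - h'
      exact mul_left_cancel₀ hu this
    exact Prod.ext e1 (Prod.ext e2 e3)
  set T₁ : Finset (F × F) := (A ×ˢ B).filter fun r =>
      r.1 * (t - r.1) - 1 ≠ 0 ∧ v * r.2 ^ 2 + (-(c' - δ * r.1)) * r.2 + u * (r.1 * (t - r.1) - 1) = 0
    with hT₁
  set T₂ : Finset (F × F) := (A.filter fun a => a * (t - a) - 1 = 0) ×ˢ B with hT₂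
  have hsub : S.image (fun p : F × F × F => (p.1, p.2.1)) ⊆ T₁ ∪ T₂ := by
    intro r hr
    obtain ⟨p, hp, rfl⟩ := Finset.mem_image.mp hr
    obtain ⟨hA, hB, hQ, hL⟩ := hS p hp
    by_cases h0 : p.1 * (t - p.1) - 1 = 0
    · exact Finset.mem_union_right _ (Finset.mem_product.mpr ⟨Finset.mem_filter.mpr ⟨hA, h0⟩, hB⟩)
    · refine Finset.mem_union_left _ (Finset.mem_filter.mpr ⟨Finset.mem_product.mpr ⟨hA, hB⟩, h0, ?_⟩)
      linear_combination u * hQ + p.2.1 * hL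
  have hT₁card : T₁.card ≤ 2 * A.card := by
    refine Finset.card_le_mul_card_image_of_maps_to (f := Prod.fst) (t := A)
      (fun r hr => (Finset.mem_product.mp (Finset.mem_filter.mp hr).1).1) 2 ?_
    intro a _
    have hsub' : (T₁.filter fun r => r.1 = a) ⊆ (Finset.univ.filter fun x : F =>
        v * x ^ 2 + (-(c' - δ * a)) * x + u * (a * (t - a) - 1) = 0).image fun x => (a, x) := by
      intro r hr
      simp only [Finset.mem_filter, hT₁, Finset.mem_product] at hr
      obtain ⟨⟨-, -, e⟩, rfl⟩ := hr
      exact Finset.mem_image.mpr ⟨r.2, Finset.mem_filter.mpr ⟨Finset.mem_univ _, e⟩, rfl⟩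
    by_cases ha : a * (t - a) - 1 = 0
    · -- then the fibre is empty
      have : (T₁.filter fun r => r.1 = a) = ∅ := by
        apply Finset.eq_empty_of_forall_notMem
        intro r hr
        simp only [Finset.mem_filter, hT₁] at hr
        obtain ⟨⟨-, hne, -⟩, rfl⟩ := hr
        exact hne ha
      rw [this]; simp
    · calc _ ≤ _ := Finset.card_le_card hsub'
        _ ≤ _ := Finset.card_image_le
        _ ≤ 2 := card_filter_quadratic_le_of_ne _ _ _ (mul_ne_zero hu ha)
  have hT₂card : T₂.card ≤ 2 * B.card := by
    rw [hT₂, Finset.card_product]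
    have : (A.filter fun a => a * (t - a) - 1 = 0).card ≤ 2 := by
      calc _ ≤ (Finset.univ.filter fun x : F => x ^ 2 + (-t) * x + 1 = 0).card := by
            apply Finset.card_le_card
            intro a ha
            simp only [Finset.mem_filter, Finset.mem_univ, true_and] at ha ⊢
            linear_combination -ha.2
        _ ≤ 2 := card_filter_quadratic_le _ _
    exact Nat.mul_le_mul_right _ this
  calc S.card = (S.image fun p : F × F × F => (p.1, p.2.1)).card :=
        (Finset.card_image_of_injOn hinj).symm
    _ ≤ (T₁ ∪ T₂).card := Finset.card_le_card hsub
    _ ≤ T₁.card + T₂.card := Finset.card_union_le _ _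
    _ ≤ 2 * A.card + 2 * B.card := Nat.add_le_add hT₁card hT₂card

/-- **Diagonal case.**  Triples `(a, x, y)` with `x, y ∈ B`, `a(t-a) - xy = 1`, `δa = c'`
(`δ ≠ 0`): at most `2|B|`. [folklore] -/
theorem card_triples_diag_le {F : Type} [Field F] [Fintype F] [DecidableEq F] (B : Finset F)
    (t δ c' : F) (hδ : δ ≠ 0) (S : Finset (F × F × F))
    (hS : ∀ p ∈ S, p.2.1 ∈ B ∧ p.2.2 ∈ B ∧ p.1 * (t - p.1) - p.2.1 * p.2.2 = 1 ∧ δ * p.1 = c') :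
    S.card ≤ 2 * B.card := by
  set a₀ : F := c' / δ with ha₀
  set ν : F := a₀ * (t - a₀) - 1 with hν
  have ha : ∀ p ∈ S, p.1 = a₀ := by
    intro p hp
    rw [ha₀, eq_div_iff hδ, mul_comm]
    exact (hS p hp).2.2.2
  have hinj : Set.InjOn (fun p : F × F × F => p.2) ↑S := by
    intro p hp p' hp' e
    exact Prod.ext ((ha p hp).trans (ha p' hp').symm) e
  have hsub : S.image (fun p : F × F × F => p.2) ⊆
      ({(0 : F)} ×ˢ B) ∪ B.image fun x => (x, ν / x) := by
    intro r hr
    obtain ⟨p, hp, rfl⟩ := Finset.mem_image.mp hr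
    obtain ⟨hB1, hB2, hQ, -⟩ := hS p hp
    have hp1 := ha p hp
    by_cases hx : p.2.1 = 0
    · exact Finset.mem_union_left _ (Finset.mem_product.mpr ⟨by simp [hx], hB2⟩)
    · refine Finset.mem_union_right _ (Finset.mem_image.mpr ⟨p.2.1, hB1, ?_⟩)
      have e : p.2.1 * p.2.2 = ν := by rw [hν, ← hp1]; linear_combination -hQ
      refine Prod.ext rfl ?_
      simp only
      rw [div_eq_iff hx]
      linear_combination -e
  calc S.card = (S.image fun p : F × F × F => p.2).card := (Finset.card_image_of_injOn hinj).symm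
    _ ≤ (({(0 : F)} ×ˢ B) ∪ B.image fun x => (x, ν / x)).card := Finset.card_le_card hsub
    _ ≤ ({(0 : F)} ×ˢ B).card + (B.image fun x => (x, ν / x)).card := Finset.card_union_le _ _
    _ ≤ B.card + B.card := by
        gcongr
        · simp
        · exact Finset.card_image_le
    _ = 2 * B.card := by ring

/-! ## The slice count -/

/-- **(D)** For `|K| = q²`, `σ = Frob_q`, `m ∈ SL₂(K)`, `m ≠ ±1`, `t c : K`:
`#{X ∈ SL₂(K) | σ(X) = X⁻¹, tr X = t, tr(m X) = c} ≤ 4q` — the shape of the hypothesis of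
`traceFibre_card_le_of_sliceCount`.  NOT summit progress. [folklore] -/
theorem subfieldCell_sliceCount_le (k K : Type) [Field k] [Fintype k] [DecidableEq k]
    [Field K] [Fintype K] [DecidableEq K] (_ι : k →+* K)
    (_hK : Fintype.card K = Fintype.card k ^ 2) (σ : K →+* K)
    (hσ : ∀ x, σ x = x ^ Fintype.card k) (m : SL(2, K)) (hm1 : m ≠ 1) (hm2 : m ≠ -1)
    (t c : K) :
    Nat.card {X : SL(2, K) // map σ X = X⁻¹ ∧ Matrix.trace (X : Matrix (Fin 2) (Fin 2) K) = t ∧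
      Matrix.trace ((m * X : SL(2, K)) : Matrix (Fin 2) (Fin 2) K) = c} ≤
      4 * Fintype.card k := by
  classical
  set q : ℕ := Fintype.card k with hq
  have hq2 : 2 ≤ q := Fintype.one_lt_card
  set M : Matrix (Fin 2) (Fin 2) K := (m : Matrix (Fin 2) (Fin 2) K) with hM
  set δ : K := M 0 0 - M 1 1 with hδ
  set c' : K := c - M 1 1 * t with hc'
  set A : Finset K := Finset.univ.filter fun a : K => a ^ q + a = t with hA
  set B : Finset K := Finset.univ.filter fun x : K => x ^ q + x = 0 with hB
  have hAcard : A.card ≤ q := card_filter_pow_add_self_le q hq2 t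
  have hBcard : B.card ≤ q := card_filter_pow_add_self_le q hq2 0
  -- the slice as a finset, and its image in triples `(a, β, γ)`
  set 𝒳 : Finset SL(2, K) := Finset.univ.filter fun X =>
      map σ X = X⁻¹ ∧ Matrix.trace (X : Matrix (Fin 2) (Fin 2) K) = t ∧
        Matrix.trace ((m * X : SL(2, K)) : Matrix (Fin 2) (Fin 2) K) = c with h𝒳
  set τ : SL(2, K) → K × K × K := fun X =>
      ((X : Matrix (Fin 2) (Fin 2) K) 0 0, (X : Matrix (Fin 2) (Fin 2) K) 0 1,
        (X : Matrix (Fin 2) (Fin 2) K) 1 0) with hτ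
  -- the entrywise facts
  have hfacts : ∀ X ∈ 𝒳,
      (X : Matrix (Fin 2) (Fin 2) K) 1 1 = t - (X : Matrix (Fin 2) (Fin 2) K) 0 0 ∧
      (X : Matrix (Fin 2) (Fin 2) K) 0 0 ∈ A ∧ (X : Matrix (Fin 2) (Fin 2) K) 0 1 ∈ B ∧
      (X : Matrix (Fin 2) (Fin 2) K) 1 0 ∈ B ∧
      (X : Matrix (Fin 2) (Fin 2) K) 0 0 * (t - (X : Matrix (Fin 2) (Fin 2) K) 0 0) -
        (X : Matrix (Fin 2) (Fin 2) K) 0 1 * (X : Matrix (Fin 2) (Fin 2) K) 1 0 = 1 ∧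
      δ * (X : Matrix (Fin 2) (Fin 2) K) 0 0 + M 1 0 * (X : Matrix (Fin 2) (Fin 2) K) 0 1 +
        M 0 1 * (X : Matrix (Fin 2) (Fin 2) K) 1 0 = c' := by
    intro X hX
    simp only [h𝒳, Finset.mem_filter, Finset.mem_univ, true_and] at hX
    obtain ⟨h1, h2, h3⟩ := hX
    set Y : Matrix (Fin 2) (Fin 2) K := (X : Matrix (Fin 2) (Fin 2) K) with hY
    have hd : Y 1 1 = t - Y 0 0 := by
      rw [Matrix.trace_fin_two] at h2; linear_combination h2
    -- entries of `σ X = X⁻¹`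
    have hent : ∀ i j, σ (Y i j) = (Y.adjugate) i j := by
      intro i j
      have := congrArg (fun g : SL(2, K) => (g : Matrix (Fin 2) (Fin 2) K) i j) h1
      simp only [frobSL_apply_coe, coe_inv] at this
      exact this
    have ha : σ (Y 0 0) = Y 1 1 := by rw [hent]; simp [Matrix.adjugate_fin_two]
    have hβ : σ (Y 0 1) = -Y 0 1 := by rw [hent]; simp [Matrix.adjugate_fin_two]
    have hγ : σ (Y 1 0) = -Y 1 0 := by rw [hent]; simp [Matrix.adjugate_fin_two]
    have hdet : Y 0 0 * Y 1 1 - Y 0 1 * Y 1 0 = 1 := by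
      have := X.det_coe; rw [Matrix.det_fin_two] at this; exact this
    have htr : M 0 0 * Y 0 0 + M 0 1 * Y 1 0 + (M 1 0 * Y 0 1 + M 1 1 * Y 1 1) = c := by
      rw [coe_mul, Matrix.trace_fin_two, Matrix.mul_apply, Matrix.mul_apply, Fin.sum_univ_two,
        Fin.sum_univ_two] at h3
      exact h3
    refine ⟨hd, ?_, ?_, ?_, ?_, ?_⟩
    · simp only [hA, Finset.mem_filter, Finset.mem_univ, true_and, ← hσ, ha, hd]; ring
    · simp only [hB, Finset.mem_filter, Finset.mem_univ, true_and, ← hσ, hβ]; ring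
    · simp only [hB, Finset.mem_filter, Finset.mem_univ, true_and, ← hσ, hγ]; ring
    · rw [← hd]; exact hdet
    · rw [hd] at htr; rw [hδ, hc']; linear_combination htr
  have hinj : Set.InjOn τ ↑𝒳 := by
    intro X hX X' hX' e
    simp only [hτ, Prod.mk.injEq] at e
    obtain ⟨e00, e01, e10⟩ := e
    have hd := (hfacts X hX).1
    have hd' := (hfacts X' hX').1
    ext i j
    fin_cases i <;> fin_cases j
    · exact e00
    · exact e01
    · exact e10
    · simp only [Fin.mk_one, Fin.isValue]; rw [hd, hd', e00]
  set S : Finset (K × K × K) := 𝒳.image τ with hS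
  have hSfacts : ∀ p ∈ S, p.1 ∈ A ∧ p.2.1 ∈ B ∧ p.2.2 ∈ B ∧
      p.1 * (t - p.1) - p.2.1 * p.2.2 = 1 ∧ δ * p.1 + M 1 0 * p.2.1 + M 0 1 * p.2.2 = c' := by
    intro p hp
    obtain ⟨X, hX, rfl⟩ := Finset.mem_image.mp hp
    exact (hfacts X hX).2
  have hcard : Nat.card {X : SL(2, K) // map σ X = X⁻¹ ∧
      Matrix.trace (X : Matrix (Fin 2) (Fin 2) K) = t ∧
      Matrix.trace ((m * X : SL(2, K)) : Matrix (Fin 2) (Fin 2) K) = c} = S.card := by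
    rw [Nat.card_eq_fintype_card, Fintype.card_subtype, hS, Finset.card_image_of_injOn hinj]
  rw [hcard]
  -- case analysis on the off-diagonal entries of `m`
  by_cases h01 : M 0 1 ≠ 0
  · calc S.card ≤ 2 * A.card + 2 * B.card :=
          card_triples_elim_le A B t δ c' (M 0 1) (M 1 0) h01 S
            (fun p hp => let h := hSfacts p hp; ⟨h.1, h.2.1, h.2.2.2.1, h.2.2.2.2⟩)
      _ ≤ 2 * q + 2 * q := Nat.add_le_add (Nat.mul_le_mul_left _ hAcard) (Nat.mul_le_mul_left _ hBcard)
      _ = 4 * q := by ring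
  by_cases h10 : M 1 0 ≠ 0
  · -- swap the roles of `β` and `γ`
    have hinj' : Set.InjOn (fun p : K × K × K => (p.1, p.2.2, p.2.1)) ↑S := by
      intro p _ p' _ e
      simp only [Prod.mk.injEq] at e
      exact Prod.ext e.1 (Prod.ext e.2.2 e.2.1)
    calc S.card = (S.image fun p : K × K × K => (p.1, p.2.2, p.2.1)).card :=
          (Finset.card_image_of_injOn hinj').symm
      _ ≤ 2 * A.card + 2 * B.card := by
          refine card_triples_elim_le A B t δ c' (M 1 0) (M 0 1) h10 _ ?_
          intro r hr
          obtain ⟨p, hp, rfl⟩ := Finset.mem_image.mp hr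
          obtain ⟨h1, h2, h3, h4, h5⟩ := hSfacts p hp
          exact ⟨h1, h3, by linear_combination h4, by linear_combination h5⟩
      _ ≤ 2 * q + 2 * q := Nat.add_le_add (Nat.mul_le_mul_left _ hAcard) (Nat.mul_le_mul_left _ hBcard)
      _ = 4 * q := by ring
  · push Not at h01 h10
    have hδ0 : δ ≠ 0 := by
      intro hδ0
      have hs : M 0 1 = 0 ∧ M 1 0 = 0 ∧ M 0 0 = M 1 1 := ⟨h01, h10, by linear_combination hδ0⟩
      rcases eq_one_or_eq_neg_one_of_scalar M hs m.det_coe with e | e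
      · exact hm1 (by ext i j; rw [← hM, e]; simp)
      · exact hm2 (by ext i j; rw [← hM, e]; simp)
    calc S.card ≤ 2 * B.card := by
          refine card_triples_diag_le B t δ c' hδ0 S ?_
          intro p hp
          obtain ⟨-, h2, h3, h4, h5⟩ := hSfacts p hp
          rw [h01, h10] at h5
          exact ⟨h2, h3, h4, by linear_combination h5⟩
      _ ≤ 2 * q := Nat.mul_le_mul_left _ hBcard
      _ ≤ 4 * q := by omega

end Summit.MatrixMultiplication.MatrixMultiplication.Theorems.GradedDesignFamily.Negative
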